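import Summits.AtomisticToContinuum.BoseEinsteinCondensation.Theses.BECCutLineWeakDisorder
import Summits.AtomisticToContinuum.BoseEinsteinCondensation.Theorems.BECCutLineWeakDisorderLandscapeBoundSiblingDefs
import Summits.AtomisticToContinuum.BoseEinsteinCondensation.Theorems.BECCutLineWeakDisorderLandscapeBoundSiblingTelescope
import Literature.MathematicalPhysics.QuantumManyBody.GroundStateFeynmanKacCutLine
import Mathlib

/-!
# Crux `TwoReplicaTransienceBound` (stmt-AtomisticToContinuum-9687) — ideator 5, round 2:
# first lemmas of the two idea cards

* Card `tagged-shift-log-harnack` (UV / kinetic-scale half): the abstract engine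
  `log_ratio_le_tilted_mean` (log-Harnack by change of measure = one Jensen step under the
  TILTED law; F.-Y. Wang, *Harnack inequalities for SPDEs* (2013) Thm 1.1.1, log form) is PROVED
  here; the typed target `KineticScaleFlatness` (the sibling line's `UVFlatness` lifted from the
  unit scale to the kinetic length `√(κ/ρ)`), its reduction `uvFlatness_of_kineticScaleFlatness`
  (monotonicity of the within-block participation in the depth; children Cauchy–Schwarz, PROVED),
  and the two classical-strength inputs `LocalCrowdingExpMoments`, `TaggedDisplacementMoments`.
* Card `slice-tensorisation-second-moment` (IR half): the typed hypotheses
  `BathSliceTensorisation` (approximate tensorisation of variance of the bath-bridge slice law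
  `ν_T ∝ Z_n(Y)² dY` over particle labels — the `ν_T`-twin of the LIVE item
  `BECHeatBathGap.ParticleTensorisation`, stmt-14367) and `KineticBlockTwoReplica` (the block
  two-replica target at the kinetic scale), plus the exact second-moment closure
  `second_moment_of_poincare` (PROVED: `Var A ≤ ι·E A² ⇒ (1-ι) E A² ≤ (E A)²`).

Nothing here is asserted about the crux; the file is sorry-free (the `def … : Prop` are targets / hypotheses).
-/

noncomputable section

open MeasureTheory Filter Set Finset
open scoped ENNReal NNReal Topology BigOperators

namespace Summit.AtomisticToContinuum.BoseEinsteinCondensation.Cruxes.TwoReplicaTransienceBound.Ideator5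

open Literature.MathematicalPhysics.QuantumManyBody.BoseGas
open Summit.AtomisticToContinuum.BoseEinsteinCondensation.Theses.BECCutLineWeakDisorder
open Summit.AtomisticToContinuum.BoseEinsteinCondensation.Cruxes.LandscapeBound.SiblingTelescopingChaining

/-! ## Part A — the abstract engine of card `tagged-shift-log-harnack` (PROVED) -/

/-- **Jensen for `e^{-D}` under a probability measure**: `exp(-∫ D dν) ≤ ∫ exp(-D) dν`. -/
theorem exp_neg_integral_le {Ω : Type*} [MeasurableSpace Ω] (ν : Measure Ω)
    [IsProbabilityMeasure ν] {D : Ω → ℝ} (hD : Integrable D ν)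
    (hexp : Integrable (fun ω => Real.exp (-D ω)) ν) :
    Real.exp (-(∫ ω, D ω ∂ν)) ≤ ∫ ω, Real.exp (-D ω) ∂ν := by
  -- convexity of `x ↦ exp (-x)` on `univ`, then Jensen (`ConvexOn.map_integral_le`)
  have hconv' : ConvexOn ℝ Set.univ (fun x : ℝ => Real.exp (-x)) := by
    have h := convexOn_exp
    -- `exp ∘ (x ↦ -x)` is convex as the composition of a convex function with a linear map
    refine ⟨convex_univ, fun x _ y _ a b ha hb hab => ?_⟩
    have := h.2 (Set.mem_univ (-x)) (Set.mem_univ (-y)) ha hb hab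
    simpa [neg_add, mul_neg, smul_eq_mul, add_comm] using this
  have hcont : ContinuousOn (fun x : ℝ => Real.exp (-x)) Set.univ :=
    (Real.continuous_exp.comp continuous_neg).continuousOn
  have hgi : Integrable ((fun x : ℝ => Real.exp (-x)) ∘ D) ν := hexp
  exact hconv'.map_integral_le hcont isClosed_univ (Eventually.of_forall fun _ => mem_univ _) hD hgi

/-- **Log-Harnack by change of measure (Gibbs-variational step; the engine of card
`tagged-shift-log-harnack`).** Let `ν` be the probability law of the early segment under the
polymer measure of apex `x'` (the TILTED law) and `D` the log-weight difference between the
apex-`x` weight transported onto apex `x'` (Cameron–Martin ramp of the tagged path) and the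
apex-`x'` weight, so that `Ψ_T(x,Y)/Ψ_T(x',Y) = ∫ e^{-D} dν`. Then
`log Ψ_T(x',Y) - log Ψ_T(x,Y) = -log ∫ e^{-D} dν ≤ ∫ D dν`:
the log-ratio of the conditional amplitudes at two apices is bounded by the TILTED MEAN of the
early-time cost `D` (ramp kinetic cost + drift work + dose mismatch on `[0, τ₀]`), uniformly in
the polymer length. -/
theorem log_ratio_le_tilted_mean {Ω : Type*} [MeasurableSpace Ω] (ν : Measure Ω)
    [IsProbabilityMeasure ν] {D : Ω → ℝ} (hD : Integrable D ν)
    (hexp : Integrable (fun ω => Real.exp (-D ω)) ν) :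
    -Real.log (∫ ω, Real.exp (-D ω) ∂ν) ≤ ∫ ω, D ω ∂ν := by
  have h := exp_neg_integral_le ν hD hexp
  have hpos : 0 < Real.exp (-(∫ ω, D ω ∂ν)) := Real.exp_pos _
  have hlog := Real.log_le_log hpos h
  rw [Real.log_exp] at hlog
  linarith

/-! ## Part B — typed statements over the crux's vocabulary -/

variable {n : ℕ}

/-- The dyadic level whose blocks have side `≈ √(κ/ρ)` (the KINETIC length: a tagged line
collects `O(κ‖v‖₁)` expected dose while diffusing across such a block):
`depth L - ⌊log₂ √(κ/ρ)⌋`, blocks of side `L·2^{-K} ∈ (√(κ/ρ)/4, √(κ/ρ)]` (natural subtraction: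
at the unit scale or coarser). -/
def kineticDepth (κ ρ L : ℝ) : ℕ := depth L - Nat.log 2 ⌊Real.sqrt (κ / ρ)⌋₊

/-- CARD 1 TARGET `KineticScaleFlatness` — **within-block flatness of the cut-line witness at the
kinetic scale, second moment under the slice law, uniformly in `n` and `T ≥ 1`, for EVERY
admissible `v`**: the sibling line's `UVFlatness` (unit scale) with the depth lowered to
`kineticDepth κ ρ L`. By `R = r̄_K · ∏_{j<K}(1+X_j)` (sibling telescoping) it absorbs the UV stub
AND the octaves below the kinetic length of `IRTailsMiddle`; what it leaves is the coarse
two-replica functional at block resolution `√(κ/ρ)`. -/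
def KineticScaleFlatness : Prop :=
  ∀ v : ℝ → ℝ≥0∞, IsRepulsiveFiniteRange v → ∃ κ : ℝ, 0 < κ ∧ ∃ ρ₀ : ℝ, 0 < ρ₀ ∧
    ∀ ρ : ℝ, 0 < ρ → ρ < ρ₀ → ∃ C : ℝ, 0 < C ∧ ∀ᶠ n : ℕ in atTop, ∀ T : ℝ, 1 ≤ T →
      ∫⁻ Y : Config n,
          (∫⁻ x, slice (fkWitness (N := n + 1) v (sideLength ρ (n + 1)) T (fun _ => (1 : ℝ≥0∞))) Y x ^ 2) *
            uvParticipation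
              (slice (fkWitness (N := n + 1) v (sideLength ρ (n + 1)) T (fun _ => (1 : ℝ≥0∞))) Y)
              (sideLength ρ (n + 1))
              (kineticDepth κ ρ (sideLength ρ (n + 1))) ^ 2 ≤
        ENNReal.ofReal C

/-- Cauchy–Schwarz for a finite `ℝ≥0∞`-sum: `(Σ_e a_e)² ≤ #s · Σ_e a_e²`. -/
theorem sq_sum_le_card_mul_sum_sq_ennreal {ι : Type*} (s : Finset ι) (a : ι → ℝ≥0∞) :
    (∑ e ∈ s, a e) ^ 2 ≤ (s.card : ℝ≥0∞) * ∑ e ∈ s, a e ^ 2 := by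
  have h := ENNReal.rpow_sum_le_const_mul_sum_rpow s a (p := 2) (by norm_num)
  norm_num at h
  simpa [ENNReal.rpow_two] using h

/-- **Children Cauchy–Schwarz: `S_j ≤ 8 S_{j+1}`** (`a_Q² = (Σ_{c⊂Q} a_c)² ≤ 8 Σ_c a_c²`). -/
theorem levelSq_le_eight_mul_succ (g : Space → ℝ≥0∞) (L : ℝ) (j : ℕ) :
    levelSq g L j ≤ 8 * levelSq g L (j + 1) := by
  rcases le_or_gt L 0 with hL | hL
  · simp [levelSq_eq_zero_of_nonpos hL]
  rw [levelSq_succ_eq, Finset.mul_sum]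
  unfold levelSq
  gcongr with i
  rw [blockMass_eq_sum_children hL]
  refine (sq_sum_le_card_mul_sum_sq_ennreal _ _).trans ?_
  simp [Fintype.card_fin, Fintype.card_pi]

/-- `S_{K'} ≤ 8^{K-K'} S_K` for `K' ≤ K` (iterate `levelSq_le_eight_mul_succ`). -/
theorem levelSq_le_pow_mul (g : Space → ℝ≥0∞) (L : ℝ) {K' K : ℕ} (h : K' ≤ K) :
    levelSq g L K' ≤ 8 ^ (K - K') * levelSq g L K := by
  obtain ⟨d, rfl⟩ := Nat.exists_eq_add_of_le h
  rw [Nat.add_sub_cancel_left]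
  induction d with
  | zero => simp
  | succ d ih =>
    calc levelSq g L K' ≤ 8 ^ d * levelSq g L (K' + d) := ih (Nat.le_add_right _ _)
      _ ≤ 8 ^ d * (8 * levelSq g L (K' + d + 1)) := by
          gcongr; exact levelSq_le_eight_mul_succ g L _
      _ = 8 ^ (d + 1) * levelSq g L (K' + (d + 1)) := by rw [pow_succ]; ring_nf

/-- **Monotonicity of the within-block participation in the depth** (children Cauchy–Schwarz
`a_Q² = (Σ_{c⊂Q} a_c)² ≤ 8 Σ_c a_c²`, i.e. `S_j ≤ 8 S_{j+1}`, whence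
`r̄_K = ℓ_K³ m/S_K ≤ ℓ_{K'}³ m/S_{K'} = r̄_{K'}` for `K' ≤ K`): coarser blocks are at least
as UN-flat as finer ones, so flatness at the kinetic scale implies flatness at the unit scale. -/
theorem uvParticipation_anti (g : Space → ℝ≥0∞) {L : ℝ} (hL : 0 ≤ L) {K' K : ℕ} (h : K' ≤ K) :
    uvParticipation g L K ≤ uvParticipation g L K' := by
  unfold uvParticipation
  set m := ∫⁻ x, g x ^ 2
  have hS := levelSq_le_pow_mul g L h
  -- `ℓ_K³ · 8^{K-K'} = ℓ_{K'}³`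
  have hℓ : ENNReal.ofReal ((L / 2 ^ K') ^ 3) =
      ENNReal.ofReal ((L / 2 ^ K) ^ 3) * 8 ^ (K - K') := by
    obtain ⟨d, rfl⟩ := Nat.exists_eq_add_of_le h
    rw [Nat.add_sub_cancel_left, show (8 : ℝ≥0∞) ^ d = ENNReal.ofReal ((8 : ℝ) ^ d) by
      rw [ENNReal.ofReal_pow (by norm_num)]; norm_num, ← ENNReal.ofReal_mul (by positivity)]
    congr 1
    rw [pow_add, div_pow, div_pow, mul_pow, show ((2 : ℝ) ^ d) ^ 3 = 8 ^ d by
      rw [← pow_mul, mul_comm, pow_mul]; norm_num]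
    field_simp
  rw [hℓ]
  have h8 : (8 : ℝ≥0∞) ^ (K - K') ≠ 0 := pow_ne_zero _ (by norm_num)
  have h8t : (8 : ℝ≥0∞) ^ (K - K') ≠ ⊤ := ENNReal.pow_ne_top (by norm_num)
  -- `ℓ_K³ m / S_K = 8^{K-K'} ℓ_K³ m / (8^{K-K'} S_K) ≤ 8^{K-K'} ℓ_K³ m / S_{K'}`
  calc ENNReal.ofReal ((L / 2 ^ K) ^ 3) * m / levelSq g L K
      = 8 ^ (K - K') * (ENNReal.ofReal ((L / 2 ^ K) ^ 3) * m) / (8 ^ (K - K') * levelSq g L K) :=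
        (ENNReal.mul_div_mul_left _ _ h8 h8t).symm
    _ ≤ 8 ^ (K - K') * (ENNReal.ofReal ((L / 2 ^ K) ^ 3) * m) / levelSq g L K' :=
        ENNReal.div_le_div_left hS _
    _ = ENNReal.ofReal ((L / 2 ^ K) ^ 3) * 8 ^ (K - K') * m / levelSq g L K' := by ring_nf

/-- **Card 1 discharges the sibling line's UV stub**: `KineticScaleFlatness → UVFlatness`
(`kineticDepth ≤ depth` and `uvParticipation_anti`). -/
theorem uvFlatness_of_kineticScaleFlatness (h : KineticScaleFlatness) : UVFlatness := by
  intro v hv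
  obtain ⟨κ, hκ, ρ₀, hρ₀, H⟩ := h v hv
  refine ⟨ρ₀, hρ₀, fun ρ hρ hρlt => ?_⟩
  obtain ⟨C, hC, hev⟩ := H ρ hρ hρlt
  refine ⟨C, hC, ?_⟩
  filter_upwards [hev] with n hn T hT
  refine le_trans (lintegral_mono fun Y => ?_) (hn T hT)
  have hL : 0 ≤ sideLength ρ (n + 1) :=
    (Real.rpow_pos_of_pos (div_pos (by exact_mod_cast Nat.succ_pos n) hρ) _).le
  gcongr
  exact uvParticipation_anti _ hL (Nat.sub_le _ _)

/-- CARD 1 INPUT (a) `LocalCrowdingExpMoments` — **Ruelle-type exponential moments of the number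
of bath particles within the interaction range `R` of a point displaced by `‖z‖ ≤ √(κ/ρ)` from
the tagged particle, under the Born law `Ψ_T² dX` of the witness, uniformly in `n`, `T ≥ 1` and
`z`** (the `fkWitness`/Dirichlet twin of `LocalNumberExpMoments` of crux 9480's line
`tagged-path-harnack-cage-moments`; classical-statistical-mechanics strength — it holds in every
no-BEC scenario, free gas: binomial counts; positive temperature: Park 1985). It prices the
dose-mismatch term of the log-Harnack cost. -/
def LocalCrowdingExpMoments : Prop :=
  ∀ v : ℝ → ℝ≥0∞, IsRepulsiveFiniteRange v → ∀ R Λ κ : ℝ, 0 < R → 0 ≤ Λ → 0 < κ →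
    ∃ ρ₀ : ℝ, 0 < ρ₀ ∧ ∀ ρ : ℝ, 0 < ρ → ρ < ρ₀ → ∃ C : ℝ, 0 < C ∧ ∀ᶠ n : ℕ in atTop,
      ∀ T : ℝ, 1 ≤ T → ∀ z : Space, ‖z‖ ≤ Real.sqrt (κ / ρ) →
        ∫⁻ X : Config (n + 1),
            ENNReal.ofReal (fkWitness (N := n + 1) v (sideLength ρ (n + 1)) T (fun _ => (1 : ℝ≥0∞)) X ^ 2 *
              Real.exp (Λ * ((Finset.univ.filter fun j : Fin (n + 1) =>
                j ≠ 0 ∧ dist (X j) (X 0 + z) < R).card : ℝ))) ≤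
          ENNReal.ofReal C

/-- CARD 1 INPUT (b) `TaggedDisplacementMoments` — **the tagged particle's displacement over an
early window of length `τ ≤ κ/ρ` after the cut has Gaussian exponential moments at the diffusive
scale, under the law of the `2T`-bridge** (cut identity `lintegral_mul_lintegral_fkWeight_two_mul`:
the bridge functional is the `2T`-system path integral started flat, read at times `T` and
`T + τ`, normalised by `‖e^{-TH}1‖₂²`). Free gas: equality with `C = 1`-type constants (heat
kernel); interacting: the drift `2∇₀ log(e^{-(T-s)H}1)` only repels from contacts and walls
(Lyons–Zheng + Khas'minskii for the contact singularity; form-energy monotonicity in `T` gives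
the `n`-uniform tagged kinetic energy). It prices the Cameron–Martin (drift-work) term. -/
def TaggedDisplacementMoments : Prop :=
  ∀ v : ℝ → ℝ≥0∞, IsRepulsiveFiniteRange v → ∀ κ a : ℝ, 0 < κ → 0 ≤ a →
    ∃ ρ₀ : ℝ, 0 < ρ₀ ∧ ∀ ρ : ℝ, 0 < ρ → ρ < ρ₀ → ∃ C : ℝ, 0 < C ∧ ∀ᶠ n : ℕ in atTop,
      ∀ T : ℝ, 1 ≤ T → ∀ τ : ℝ, 0 ≤ τ → τ ≤ κ / ρ →
        ∫⁻ X₀ : Config (n + 1), ∫⁻ ω,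
            fkWeight v (sideLength ρ (n + 1)) (2 * T) X₀ ω *
              ENNReal.ofReal (Real.exp (a / Real.sqrt (τ + 1) *
                ‖worldLine X₀ ω (T + τ).toNNReal 0 - worldLine X₀ ω T.toNNReal 0‖))
          ∂wienerPaths (n + 1) ≤
        ENNReal.ofReal (C * Real.exp (C * a ^ 2)) *
          fkNormSq (N := n + 1) v (sideLength ρ (n + 1)) T (fun _ => (1 : ℝ≥0∞))

/-! ## Part C — typed statements of card `slice-tensorisation-second-moment` (IR half) -/

/-- **The exact second-moment closure** (PROVED): a restricted Poincaré/tensorisation bound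
`E A² - (E A)² ≤ ι · E A²` with `ι < 1` IS a two-replica bound `(1 - ι) E A² ≤ (E A)²` — no
exponential moments, no cumulants. -/
theorem second_moment_of_poincare {EA EA2 ι : ℝ} (hvar : EA2 - EA ^ 2 ≤ ι * EA2) :
    (1 - ι) * EA2 ≤ EA ^ 2 := by
  nlinarith

/-- The bath-only partition function `Z_n(Y) = (e^{-TH_n}1)(Y)` of the `n` bath lines (no tagged
particle) in the box of the `(n+1)`-particle problem at density `ρ`. -/
def bathZ (v : ℝ → ℝ≥0∞) (ρ T : ℝ) (n : ℕ) (Y : Config n) : ℝ≥0∞ :=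
  fkPartition (N := n) v (sideLength ρ (n + 1)) T Y

/-- The (unnormalised) density `Z_n(Y)²` of the **bath-bridge slice law** `ν_T` — the time-`0`
marginal of the `2T`-long flat-datum bridge of the `n` bath lines ALONE (cut identity at `g = 1`);
the crux's slice law `m(Y) dY` is `ν_T` size-biased by `∫ ĝ_Y(x)² dx`. -/
def bathSliceDensity (v : ℝ → ℝ≥0∞) (ρ T : ℝ) (n : ℕ) (Y : Config n) : ℝ≥0∞ :=
  bathZ v ρ T n Y ^ 2

/-- The **block insertion amplitude** `A_Q(Y) = ∫_Q Z_{n+1}(x :: Y) dx`, `Q` = the dyadic block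
`(j, i)` of the box: the bath-conditioned survival mass of a `T`-long tagged line inserted at time
`0` uniformly in the block `Q` of the bath slice `Y` (times `Z_n(Y)`; the ratio `A_Q/Z_n` is the
block mass of the insertion profile `ĝ_Y`). -/
def blockAmplitude (v : ℝ → ℝ≥0∞) (ρ T : ℝ) (n : ℕ) (j : ℕ) (i : Fin 3 → Fin (2 ^ j))
    (Y : Config n) : ℝ≥0∞ :=
  blockMass (fun x => fkPartition (N := n + 1) v (sideLength ρ (n + 1)) T (Matrix.vecCons x Y))
    (sideLength ρ (n + 1)) j i

/-- CARD 2 HYPOTHESIS `BathSliceTensorisation` — **approximate tensorisation of variance of the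
bath-bridge slice law `ν_T ∝ Z_n(Y)² dY` over particle labels, constant uniform in `n` and
`T ≥ 1`** (division-free form, exactly the shape of the LIVE item
`BECHeatBathGap.ParticleTensorisation` stmt-14367 with the near-minimiser's Born law replaced by
`ν_T`): for every real `F` and all predictors `g_i` not depending on `Y_i`,
`min_c ∫ (F - c)² Z_n² ≤ C Σ_i ∫ (F - g_i)² Z_n²` — the inverse spectral gap of the heat-bath
sampler that relocates ONE bath particle from its conditional slice law, a NON-LOCAL move blind
to the kinetic gap. Per box trivially finite; `T ≲ 1/(ρ‖v‖₁)`: Dobrushin regime; large `T`: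
uncharted (the `|φ₀|²` case is 14367's why-might-fail). -/
def BathSliceTensorisation : Prop :=
  ∀ v : ℝ → ℝ≥0∞, IsRepulsiveFiniteRange v → ∃ ρ₀ : ℝ, 0 < ρ₀ ∧ ∃ C : ℝ, 0 < C ∧
    ∀ ρ : ℝ, 0 < ρ → ρ < ρ₀ → ∀ᶠ n : ℕ in atTop, ∀ T : ℝ, 1 ≤ T →
      ∀ (F : Config n → ℝ) (g : Fin n → Config n → ℝ), Measurable F → (∀ i, Measurable (g i)) →
        (∀ i Y (y : Space), g i (Function.update Y i y) = g i Y) →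
        ∃ c : ℝ, ∫⁻ Y, ENNReal.ofReal ((F Y - c) ^ 2) * bathSliceDensity v ρ T n Y ≤
          ENNReal.ofReal C * ∑ i : Fin n,
            ∫⁻ Y, ENNReal.ofReal ((F Y - g i Y) ^ 2) * bathSliceDensity v ρ T n Y

/-- CARD 2 TARGET `KineticBlockTwoReplica` — **the two-replica bound at kinetic-block resolution
under the UNBIASED bath slice law**: `E_ν[A_Q²] ≤ C (E_ν[A_Q])²` for every dyadic block of the
kinetic level, uniformly in `n`, `T ≥ 1` (past and future tagged half-lines inserted in the same
block vs. in independent positions — the infrared heart of the crux with everything below the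
kinetic length removed; implied by the crux up to wall/size-bias bookkeeping, and with
`KineticScaleFlatness` + block decorrelation giving it back). -/
def KineticBlockTwoReplica : Prop :=
  ∀ v : ℝ → ℝ≥0∞, IsRepulsiveFiniteRange v → ∃ κ : ℝ, 0 < κ ∧ ∃ ρ₀ : ℝ, 0 < ρ₀ ∧
    ∀ ρ : ℝ, 0 < ρ → ρ < ρ₀ → ∃ C : ℝ, 0 < C ∧ ∀ᶠ n : ℕ in atTop, ∀ T : ℝ, 1 ≤ T →
      ∀ i : Fin 3 → Fin (2 ^ kineticDepth κ ρ (sideLength ρ (n + 1))),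
        (∫⁻ Y, bathSliceDensity v ρ T n Y) *
            ∫⁻ Y, blockAmplitude v ρ T n (kineticDepth κ ρ (sideLength ρ (n + 1))) i Y ^ 2 *
              bathSliceDensity v ρ T n Y ≤
          ENNReal.ofReal C *
            (∫⁻ Y, blockAmplitude v ρ T n (kineticDepth κ ρ (sideLength ρ (n + 1))) i Y *
              bathSliceDensity v ρ T n Y) ^ 2

end Summit.AtomisticToContinuum.BoseEinsteinCondensation.Cruxes.TwoReplicaTransienceBound.Ideator5

end
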